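import Summits.HubbardSuperconductivity.HubbardSuperconductivity.Theorems.LevyLogBootstrapDressHalfFilledW1KernelWindowTwo
import HarnessLib

/-!
# Route `PolyaSchurPairBoson`, crux `DressAnyFilling` (stmt-HubbardSuperconductivity-10291): the registered stub
# `stub_kineticGlueInWindow` of its skeleton `Cruxes/DressAnyFilling/Lines/birth.lean`, BY NAME

The birth skeletons of the two dressing cruxes `DressHalfFilled` (stmt-8148) and `DressAnyFilling` (stmt-10291) share the
statement abbreviation `PlaquetteData U` VERBATIM and the same stub 1, `∃ U : ℝ, 0 < U ∧ PlaquetteData U`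
(`stub_plaquetteData` there, `stub_kineticGlueInWindow` here; "one certificate proof serves both cruxes", skeleton registrar
2026-08-17). The certificate is landed in `…Theorems.LevyLogBootstrap` (`…DressHalfFilledW1KernelWindowTwo`: the
Kato-kernel window (W1) at `U = 2` by the block-Sylvester certificate chain, plus (W2)–(W5) of `…PlaquetteData`); this
file states the stub of the `DressAnyFilling` skeleton by name in the sister route's namespace and proves it by that theorem.

HONEST LABEL: closes ONE registered stub (stub 1 of 3) of the birth line of `DressAnyFilling`; its stub 3 (dressing
stability — the open statement) remains; no crux and no summit statement is proved.

References: H. Yao, W.-F. Tsai, S. A. Kivelson, PRB 76 (2007) 161104(R), eq. (2), p. 4 [YaoTsaiKivelson2007]; W.-F. Tsai,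
S. A. Kivelson, PRB 73 (2006) 214510, App. A [TsaiKivelson2006]. No definition and no named fact is introduced.
-/

set_option linter.dupNamespace false

noncomputable section

namespace Summit.HubbardSuperconductivity.HubbardSuperconductivity.Theorems.PolyaSchurPairBoson

open Summit.HubbardSuperconductivity.HubbardSuperconductivity.Theorems.LevyLogBootstrap (PlaquetteData)

/-- **Registered stub `stub_kineticGlueInWindow` of `Cruxes/DressAnyFilling/Lines/birth.lean`, BY NAME, signature
verbatim**: some coupling `U > 0` (namely `U = 2`) carries the plaquette data — the certified Kato-kernel window
`0 < J(2)`, `0 ≤ V(2) < 2J(2)` together with (W2)–(W5) (`…Theorems.LevyLogBootstrap.stub_plaquetteData`, same abbreviation).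
[cite: YaoTsaiKivelson2007, eq. (2)] -/
theorem stub_kineticGlueInWindow : ∃ U : ℝ, 0 < U ∧ PlaquetteData U :=
  Summit.HubbardSuperconductivity.HubbardSuperconductivity.Theorems.LevyLogBootstrap.stub_plaquetteData

end Summit.HubbardSuperconductivity.HubbardSuperconductivity.Theorems.PolyaSchurPairBoson

end
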